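import Summits.Langlands.Langlands.Theorems.IrreducibilityBySelfDualityReciprocityUpToIrreducibilityRecGLTwoUnramified
import Summits.Langlands.Langlands.Theorems.IrreducibilityBySelfDualityReciprocityUpToIrreducibilityTransportFrobCharpoly
import Summits.Langlands.Langlands.Theorems.IrreducibilityBySelfDualityReciprocityUpToIrreducibilityRankOneUnramified
import Literature.NumberTheory.Automorphic.CarayolCompatibilityOfLocalGlobalProofs
import HarnessLib

/-!
# Line `Sketch` for the crux `ReciprocityUpToIrreducibility` (item stmt-Langlands-14328), continuation c5:
# stub C2-above — rank two, `v ∣ ℓ`, `ρ` unramified at `v`: local–global compatibility at an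
# unramified place of `π` forces Satake–Frobenius compatibility

Support file (closes nothing; registered stub `stub_rankTwo_satake_of_localGlobal_above_of_isUnramifiedAt`
of the checked skeleton `Lines/Sketch.lean`, wave 4 of continuation lead c5).

Under the T0 named fact `FontaineDatumExists`, let `π` be cuspidal on `GL₂(𝔸_K)` and unramified at a
place `v ∣ ℓ` (Satake parameter `α`), `ρ : Γ_K → GL₂(ℚ̄_ℓ)` unramified at `v`, `ι : ℚ̄_ℓ ≃ ℂ` and `Rec`
ANY reciprocity data.  Then the summit's local–global clause `LocalGlobalCompatibleAt Rec ι π ρ v`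
implies the Satake clause `SatakeFrobCompatibleAt ι π ρ v`:

* c3's clause-(F8) reduction `exists_of_localGlobalCompatibleAt_above_of_isUnramifiedAt` turns the
  clause into a local component `π_v` and a transport `rℂ` of `(ρ|_{W_{K_v}}, N = 0)` along `ι` with
  `rℂ^{F-ss} ∈ rec_v(π_v)`;
* the automorphic side (stub H3 `stub_recGL_two_unramified`) computes `char(rℂ^{F-ss}(Φ)) =
  ∏_{a ∈ α} (X - a)` at every geometric Frobenius `Φ`, and `rℂ(Φ) = rℂ^{F-ss}(Φ) + (commuting
  nilpotent)` has the same characteristic polynomial (`LinearMap.charpoly_add_eq_of_isNilpotent_of_commute`);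
* the Galois side (`hasFrobCharpolyAt_of_isTransportAlong_charpoly_aboveConv`, rank `n`): the
  transport is entrywise `ι`, so `char(ρ(Φ)) = ∏ (X - ι⁻¹(a))`; `res(Φ⁻¹)` is an arithmetic Frobenius
  at the prime `𝔓₀ ∣ v` cut out by the completion (`isArithFrobAt_absGaloisRestrict_adicCompletionPrime_iff`),
  `char(M⁻¹) = ∏ (X - b⁻¹)` (`charpoly_inv_of_charpoly_eq_prod`), which is
  `arithFrobPolyOfSatake ι q_v 1 α`, and Frobenii at `v` are conjugate modulo inertia
  (`IsUnramifiedAt.hasFrobCharpolyAt_charpoly`) — the argument of the rank-2 tree template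
  `FramedGaloisRep.isUnramifiedAt_and_hasFrobCharpolyAt_of_weilDeligne` with the recipe
  `IsWeilDeligneOfLadic` replaced by the transport of `(ρ|_{W_{K_v}}, 0)` itself.

No definitions; std axioms.
-/

noncomputable section

set_option linter.dupNamespace false -- project-wide option (lakefile weak.linter.dupNamespace); `Summit.Langlands.Langlands` is the mandated namespace

open scoped MatrixGroups Matrix NumberField Classical Polynomial
open Filter IsDedekindDomain Field Polynomial
open Literature.NumberTheory.Automorphic Literature.NumberTheory.GaloisRepresentations
open Literature.NumberTheory.PAdicHodge
open Summit.Langlands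
open Summit.Langlands.Langlands.Theorems.VarmaWeilTracesUnramified

namespace Summit.Langlands.Langlands.Theorems.ReciprocityUpToIrreducibility

section RankNGaloisSide

variable {K : Type} [Field K] [NumberField K] {ℓ : ℕ} [Fact ℓ.Prime] {n : ℕ}

/-- **Rank `n`, from the transport of `(ρ|_{W_{K_v}}, 0)` back to the Satake clause.**  Let
`ρ : Γ_K → GL_n(ℚ̄_ℓ)` be unramified at `v` and `rℂ` a transport of `(ρ|_{W_{K_v}}, N = 0)` along
`ι : ℚ̄_ℓ ≃ ℂ` whose geometric Frobenii `Φ` (`deg Φ = -1`) have characteristic polynomial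
`∏_{a ∈ α} (X - a)`.  Then every arithmetic Frobenius of `ρ` at `v` has characteristic polynomial
`arithFrobPolyOfSatake ι q_v 1 α = ∏_{a ∈ α} (X - ι⁻¹(a⁻¹))`: pick a geometric Frobenius `Φ`
(`WeilGroup.deg_surjective`); the transport is entrywise `ι` (`toMatrix'_weilRestrict`,
`Matrix.charpoly_map`), so `char(ρ(Φ)) = ∏ (X - ι⁻¹(a))`; `res(Φ⁻¹)` is an arithmetic Frobenius at
the prime `𝔓₀ ∣ v` of the completion (`isArithFrobAt_absGaloisRestrict_adicCompletionPrime_iff`) with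
`ρ(res Φ⁻¹) = ρ(Φ)⁻¹`, `char(M⁻¹) = ∏ (X - b⁻¹)` (`charpoly_inv_of_charpoly_eq_prod`), and since `ρ`
is unramified at `v` all Frobenii at all primes above `v` share this characteristic polynomial
(`IsUnramifiedAt.hasFrobCharpolyAt_charpoly`). [cite: TateCorvallis1979, (4.1.3)–(4.2.1)]
[cite: NeukirchANT1999, Ch. II §9 Prop. (9.6)] [cite: SerreAbelianLadic1968, Ch. I §2.1] -/
theorem hasFrobCharpolyAt_of_isTransportAlong_charpoly_aboveConv (ι : PadicAlgCl ℓ ≃+* ℂ)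
    (ρ : FramedGaloisRep K (PadicAlgCl ℓ) n) (v : HeightOneSpectrum (𝓞 K)) (hρ : ρ.IsUnramifiedAt v)
    (α : Multiset ℂ) (rℂ : WeilDeligneRep (v.adicCompletion K) ℂ (Fin n → ℂ))
    (htr : (WeilDeligneRep.ofRep ((ρ.toLocal v).weilRestrict (v.adicCompletion K))
      (isLocallyUnramified_toLocal_of_isUnramifiedAt ρ v hρ).isUnramifiedRep_weilRestrict.isContinuousRep).IsTransportAlong
        (ι : PadicAlgCl ℓ →+* ℂ) rℂ)
    (hch : ∀ Φ : WeilGroup (v.adicCompletion K), WeilGroup.deg Φ = -1 →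
      (rℂ.ρ Φ).charpoly = (α.map fun a => X - C a).prod) :
    ρ.HasFrobCharpolyAt v (arithFrobPolyOfSatake ι v.residueCard 1 α) := by
  classical
  have hιinj : Function.Injective (ι : PadicAlgCl ℓ →+* ℂ) := (ι : PadicAlgCl ℓ →+* ℂ).injective
  -- (a) a geometric Frobenius `Φ`, and the arithmetic Frobenius `res(Φ⁻¹)` at `𝔓₀`
  obtain ⟨Φ, hΦ⟩ := WeilGroup.deg_surjective IsFrobPow.mul_holds IsFrobPow.unique_holds
    (exists_isFrobPow_holds (v.adicCompletion K)) (-1 : ℤ)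
  set τ : absoluteGaloisGroup (v.adicCompletion K) := WeilGroup.toAbsGalois (v.adicCompletion K) Φ
    with hτ
  have hτ' : IsFrobPow τ (-1) := by
    simpa [hΦ] using WeilGroup.isFrobPow_deg IsFrobPow.mul_holds Φ
  have hτinv : IsAbsArithFrob τ⁻¹ := by
    have h := hτ'.inv
    rw [neg_neg] at h
    exact isFrobPow_one_iff_isAbsArithFrob_holds.mp h
  have hq : IsNonarchimedeanLocalField.residueFieldCard (v.adicCompletion K) =
      Nat.card (𝓞 K ⧸ v.asIdeal) :=
    (residueFieldCard_adicCompletion_eq K v).trans (HeightOneSpectrum.residueCard_eq_card_quotient v)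
  set σ : absoluteGaloisGroup K := absGaloisRestrict K (v.adicCompletion K) τ⁻¹ with hσ_def
  have hσ : IsArithFrobAt (𝓞 K) σ (adicCompletionPrime K v) :=
    (isArithFrobAt_absGaloisRestrict_adicCompletionPrime_iff K v hq τ⁻¹).mpr hτinv
  -- (b) the matrices: `[rℂ.ρ Φ] = ι [ρ(Φ)]` and `ρ(σ) = ρ(Φ)⁻¹`
  set ME : Matrix (Fin n) (Fin n) (PadicAlgCl ℓ) :=
    (((ρ.toLocal v).toWeilGroupHom Φ : GL (Fin n) (PadicAlgCl ℓ)) :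
      Matrix (Fin n) (Fin n) (PadicAlgCl ℓ)) with hME
  have hM : LinearMap.toMatrix' (rℂ.ρ Φ) = ME.map (ι : PadicAlgCl ℓ →+* ℂ) := by
    rw [htr.1 Φ, WeilDeligneRep.ofRep_ρ, toMatrix'_weilRestrict]
  have hrσ : ((ρ σ : GL (Fin n) (PadicAlgCl ℓ)) : Matrix (Fin n) (Fin n) (PadicAlgCl ℓ)) = ME⁻¹ := by
    have h1 : ρ σ = ((ρ.toLocal v).toWeilGroupHom Φ)⁻¹ := by
      rw [hσ_def, ← FramedGaloisRep.toLocal_apply, map_inv, FramedRep.toWeilGroupHom_apply]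
    rw [h1, Matrix.coe_units_inv]
  -- `char(ME) = ∏ (X - ι⁻¹ a)` since after `ι` it is `char(rℂ.ρ Φ) = ∏ (X - a)`
  have hchME : ME.charpoly = ((α.map fun a => ι.symm a).map fun c => X - C c).prod := by
    rw [Multiset.map_map]
    apply Polynomial.map_injective (ι : PadicAlgCl ℓ →+* ℂ) hιinj
    rw [← Matrix.charpoly_map, ← hM, ← charpoly_eq_charpoly_toMatrix', hch Φ hΦ,
      Polynomial.map_multiset_prod, Multiset.map_map]
    refine congrArg _ (Multiset.map_congr rfl fun a _ => ?_)
    simp only [Function.comp_apply, Polynomial.map_sub, Polynomial.map_X, Polynomial.map_C,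
      RingHom.coe_coe, RingEquiv.apply_symm_apply]
  -- `char(ρ σ) = char(ME⁻¹) = ∏ (X - (ι⁻¹ a)⁻¹) = arithFrobPolyOfSatake ι q_v 1 α`
  have hcharE : FramedRep.charpoly ρ σ = arithFrobPolyOfSatake ι v.residueCard 1 α := by
    unfold FramedRep.charpoly
    rw [hrσ, Summit.Langlands.Langlands.Cruxes.MuOrdinaryFamilyRT.CharZeroDominance.charpoly_inv_of_charpoly_eq_prod
      (Units.isUnit _) hchME, arithFrobPolyOfSatake_one, Multiset.map_map]
    refine congrArg _ (Multiset.map_congr rfl fun a _ => ?_)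
    simp only [Function.comp_apply, map_inv₀]
  -- (c) all Frobenii at all primes above `v` (`ρ` is unramified at `v`)
  have hunr' : ρ.toGaloisRep.IsUnramifiedAt v := (ρ.isUnramifiedAt_toGaloisRep_iff v).mpr hρ
  have hP := hunr'.hasFrobCharpolyAt_charpoly (adicCompletionPrime_mem_primesAbove K v) hσ
  have hP' := (FramedGaloisRep.hasFrobCharpolyAt_toGaloisRep_iff v _ ρ).mp hP
  have hPeq : FramedRep.charpoly ρ σ = (ρ.toGaloisRep σ).charpoly :=
    hP' _ (adicCompletionPrime_mem_primesAbove K v) σ hσ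
  rw [← hcharE, hPeq]
  exact hP'

/-- **The characteristic polynomials of `rℂ` and of its Frobenius-semisimplification agree**:
if `r'` is a Frobenius-semisimplification of `rℂ` then `char(rℂ.ρ w) = char(r'.ρ w)` for every
`w ∈ W_F` (`rℂ.ρ w = r'.ρ w + m` with `m` nilpotent commuting with `r'.ρ w`,
`LinearMap.charpoly_add_eq_of_isNilpotent_of_commute`). [cite: DeligneAntwerpII1973, §8.5–8.6]
[cite: TateCorvallis1979, (4.1.3)] -/
theorem charpoly_eq_of_isFrobSemisimplificationOf_aboveConv
    {F : Type} [Field F] [ValuativeRel F] [TopologicalSpace F] [IsNonarchimedeanLocalField F] {m : ℕ}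
    {r' r : WeilDeligneRep F ℂ (Fin m → ℂ)} (h : r'.IsFrobSemisimplificationOf r) (w : WeilGroup F) :
    (r.ρ w).charpoly = (r'.ρ w).charpoly := by
  obtain ⟨-, m, hm, hc, hsum⟩ := h.2.2 w
  rw [hsum]
  exact LinearMap.charpoly_add_eq_of_isNilpotent_of_commute hm hc

end RankNGaloisSide

section RankTwoConverseAbove

variable {K : Type} [Field K] [NumberField K] {ℓ : ℕ} [Fact ℓ.Prime]

/-- **Rank two, `v ∣ ℓ`, `ρ` unramified at `v`: local–global compatibility at an unramified place of
`π` implies Satake–Frobenius compatibility, for EVERY `Rec`** (under `FontaineDatumExists`).  By c3's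
(F8) reduction `exists_of_localGlobalCompatibleAt_above_of_isUnramifiedAt` the clause yields a local
component `π_v` and a transport `rℂ` of `(ρ|_{W_{K_v}}, 0)` along `ι` with `rℂ^{F-ss} ∈ rec_v(π_v)`;
stub H3 (`stub_recGL_two_unramified`: clause (iii-L) of `Rec.llc v`, the spherical zeta integral of
`GL₂ × GL₁`, genericity and the Satake dictionary of cuspidal local components) gives
`char(rℂ^{F-ss}(Φ)) = ∏_{a ∈ α} (X - a)` at every geometric Frobenius `Φ`, hence the same for `rℂ(Φ)`
(`charpoly_eq_of_isFrobSemisimplificationOf_aboveConv`); the Galois side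
`hasFrobCharpolyAt_of_isTransportAlong_charpoly_aboveConv` returns the Satake clause
`char(Frob_v^{arith}) = arithFrobPolyOfSatake ι q_v 1 α`. [cite: FontaineAsterisque223VIII, §2.3.7]
[cite: BuzzardGeeLMS2014, Conj. 3.2.1–3.2.2] [cite: TateCorvallis1979, (4.2.1)]
[cite: HarrisTaylorAMS2001, Thm. A (ii), (v)] -/
theorem rankTwo_satakeFrobCompatibleAt_of_localGlobalCompatibleAt_above_aboveConv
    (hF : FontaineDatumExists) {hcpt : isCompact_glFiniteIntegralLevel 2 K} (Rec : ReciprocityData K)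
    (ι : PadicAlgCl ℓ ≃+* ℂ) (π : CuspidalAutomorphicRepData 2 K hcpt) (ρ : FramedGaloisRep K (PadicAlgCl ℓ) 2)
    (v : HeightOneSpectrum (𝓞 K)) (hv : ((ℓ : ℕ) : 𝓞 K) ∈ v.asIdeal) (hρ : ρ.IsUnramifiedAt v)
    (hπ : π.1.IsUnramifiedAt v) (hLG : LocalGlobalCompatibleAt Rec ι π.1 ρ v) :
    SatakeFrobCompatibleAt ι π.1 ρ v := by
  obtain ⟨α, hα⟩ := hπ
  obtain ⟨πv, rℂ, hloc, htr, r', hr', hc⟩ :=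
    exists_of_localGlobalCompatibleAt_above_of_isUnramifiedAt hF Rec ι π.1 ρ hv hρ hLG
  -- automorphic side (stub H3) at the Frobenius-semisimplification `r'` of `rℂ`
  obtain ⟨-, -, hchar'⟩ := stub_recGL_two_unramified K hcpt π v α hα (Rec.llc v) πv hloc r'
    hr'.isFrobSemisimple hc.symm
  -- same characteristic polynomials for `rℂ`, then the Galois side
  refine ⟨α, hα, hρ, hasFrobCharpolyAt_of_isTransportAlong_charpoly_aboveConv ι ρ v hρ α rℂ htr
    fun Φ hΦ => ?_⟩
  rw [charpoly_eq_of_isFrobSemisimplificationOf_aboveConv hr' Φ, hchar' Φ hΦ]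

/-- **Registered stub `stub_rankTwo_satake_of_localGlobal_above_of_isUnramifiedAt` (C2-above) of line
`Sketch` (crux stmt-Langlands-14328), closed form of
`rankTwo_satakeFrobCompatibleAt_of_localGlobalCompatibleAt_above_aboveConv`**: under
`FontaineDatumExists`, for `GL₂`, every `Rec`, every place `v ∣ ℓ` at which BOTH the cuspidal `π` and
`ρ` are unramified, the summit's local–global clause `LocalGlobalCompatibleAt Rec ι π ρ v` implies the
Satake clause `SatakeFrobCompatibleAt ι π ρ v` ((F8) reduction of c3 + stub H3 + the Frobenius
dictionary of the completion). [cite: FontaineAsterisque223VIII, §2.3.7]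
[cite: BuzzardGeeLMS2014, Conj. 3.2.1–3.2.2] [cite: TateCorvallis1979, (4.2.1)] -/
theorem stub_rankTwo_satake_of_localGlobal_above_of_isUnramifiedAt :
    FontaineDatumExists → ∀ (K : Type) [Field K] [NumberField K] (ℓ : ℕ) [Fact ℓ.Prime]
      (hcpt : isCompact_glFiniteIntegralLevel 2 K) (Rec : ReciprocityData K) (ι : PadicAlgCl ℓ ≃+* ℂ)
      (π : CuspidalAutomorphicRepData 2 K hcpt) (ρ : FramedGaloisRep K (PadicAlgCl ℓ) 2)
      (v : HeightOneSpectrum (𝓞 K)), ((ℓ : ℕ) : 𝓞 K) ∈ v.asIdeal → ρ.IsUnramifiedAt v → π.1.IsUnramifiedAt v →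
      LocalGlobalCompatibleAt Rec ι π.1 ρ v → SatakeFrobCompatibleAt ι π.1 ρ v :=
  fun hF _ _ _ _ _ _ Rec ι π ρ v hv hρ hπ hLG =>
    rankTwo_satakeFrobCompatibleAt_of_localGlobalCompatibleAt_above_aboveConv hF Rec ι π ρ v hv hρ hπ hLG

end RankTwoConverseAbove

end Summit.Langlands.Langlands.Theorems.ReciprocityUpToIrreducibility

end
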